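import Summits.AtomisticToContinuum.HydrodynamicLimit.Theses.JParityClosure
import Summits.AtomisticToContinuum.HydrodynamicLimit.Theses.LimitCollisionMeasure
import Summits.AtomisticToContinuum.HydrodynamicLimit.Theorems.JParityClosureParityInBandEnergyTight
import Literature.Analysis.FluidPDE.EmpiricalCollisionMeasure
import HarnessLib

/-!
# Tightness of the Metropolis rejection statistic of the collision record from quartic collision
tightness (stub `stub_maxwellDefectTight`)

Helper for the line `Sketch` of the crux `JParityClosure.ParityBandClosure`
(stmt-AtomisticToContinuum-17608), sub-goal of the skeleton stubs `stub_maxwellDefectVanishes` /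
`stub_isotropyOfMaxwellDefect`.

WHAT. GIVEN the moment tightness of the normalised empirical collision measure
(`LimitCollisionMeasure.CollisionTightness`, stmt-13354: for local Gibbs data,
`P(Kb < (ε/(N+1)) ∫ (1 + |v⁻|⁴ + |v*⁻|⁴)(1 + 1/(π|v⁻ − v*⁻|)) dκ_N) ≤ δ` eventually in `N`), the
Metropolis REJECTION statistic of the collision record,
`D = K_N[χ(s, xᵢ) · g(σ³ρ_r(s, xᵢ)) · (1 − min(1, e^{−F}))]`, `F` the surprisal jump of the
`(r, ϑ)`-mollified empirical law across the collision, is tight: `P(K < |D|) ≤ δ` eventually in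
`N`, for a level `K` depending on `χ, g, σ, r, τ` and the tightness level `Kb` only.

PROOF (bounded mark, domination by the count). (1) The rejection mark `1 − min(1, e^{−F})` lies in
`[0, 1]` for every real `F` (`abs_one_sub_min_one_exp_le`). (2) `χ` is continuous on the compact
`[0, τ] × 𝕋³`, hence bounded there by some `Cχ` (`exists_bound_on_slab`), and all collision times
of the functional lie in `[0, τ]`; `g` is continuous, hence bounded by some `Cg` on the compact
interval `[0, σ³ · 3/(πr³)]` (`exists_bound_on_Icc`), which contains every value `σ³ρ_r` since the
tent `b_r ∈ [0, 3/(πr³)]` and the empirical measure of `N + 1` particles is a probability measure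
(`tent_integral_bounds`). (3) Hence `|mark| ≤ Cχ·Cg` (`abs_mark_le`) and, along a good orbit, where
the collision times in `[0, τ]` are finitely many and the integral against the empirical collision
measure IS the ordered-contact-pair collision sum
(`HardSphereFlow.integral_empiricalCollisionMeasure_eq_finsum_ite`),
`|D| ≤ Cχ·Cg · K_N[1] ≤ Cχ·Cg · (ε/(N+1)) ∫ (1 + |v⁻|⁴ + |v*⁻|⁴)(1 + 1/(π|v⁻ − v*⁻|)) dκ_N`, the
integrand being `≥ 1` (`bounded_functional_le`). (4) With `K = Cχ·Cg·max(Kb, 0)`, on the good set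
`K < |D|` forces the tightness functional above `Kb`; the bad set is null for the local Gibbs law
(`localGibbsLaw_compl_good`), and the tightness bound closes (`measure_bounded_event_le`). This is
the same domination-by-13354 bookkeeping as
`ChaosClosesEulerCollisionMomentUI.measure_tail_event_le` (quadratic mark), here for a bounded mark.

REFERENCES. M. Pulvirenti, S. Simonella, *On the evolution of the empirical measure for the
hard-sphere dynamics*, arXiv:1504.03215, §3 Thm 1 (the collision sums of one trajectory);
C. Cercignani, R. Illner, M. Pulvirenti, *The Mathematical Theory of Dilute Gases*, 1994, §4.2.
-/

noncomputable section

namespace Summit.AtomisticToContinuum.HydrodynamicLimit.Theorems.ParityBandClosureMaxwellDefect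

open scoped BigOperators ENNReal
open MeasureTheory
open Literature.MathematicalPhysics.KineticTheory Literature.Analysis.FluidPDE
open Summit.AtomisticToContinuum.HydrodynamicLimit.Theses

/-! ## §1 Scalar facts: the rejection mark is in `[0, 1]`, bounded marks -/

/-- The Metropolis rejection probability `1 − min(1, e^{−F})` has absolute value at most `1`
(it lies in `[0, 1)`). [folklore] -/
theorem abs_one_sub_min_one_exp_le (F : ℝ) : |1 - min 1 (Real.exp (-F))| ≤ 1 := by
  rw [abs_le]
  constructor
  · linarith [min_le_left (1 : ℝ) (Real.exp (-F))]
  · linarith [lt_min one_pos (Real.exp_pos (-F))]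

/-- A product mark `a · b · (1 − min(1, e^{−F}))` with `|a| ≤ Ca`, `|b| ≤ Cb` is bounded by
`Ca · Cb`. [folklore] -/
theorem abs_mark_le {a b Ca Cb : ℝ} (ha : |a| ≤ Ca) (hb : |b| ≤ Cb) (F : ℝ) :
    |a * b * (1 - min 1 (Real.exp (-F)))| ≤ Ca * Cb := by
  have hCa : 0 ≤ Ca := (abs_nonneg a).trans ha
  have hCb : 0 ≤ Cb := (abs_nonneg b).trans hb
  rw [abs_mul, abs_mul]
  calc |a| * |b| * |1 - min 1 (Real.exp (-F))| ≤ Ca * Cb * 1 :=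
        mul_le_mul (mul_le_mul ha hb (abs_nonneg b) hCa) (abs_one_sub_min_one_exp_le F)
          (abs_nonneg _) (mul_nonneg hCa hCb)
    _ = Ca * Cb := mul_one _

/-- The de-fluxed quartic weight of the tightness functional is at least `1`. [folklore] -/
theorem one_le_weight (v w : V3) :
    (1 : ℝ) ≤ (1 + ‖v‖ ^ 4 + ‖w‖ ^ 4) * (1 + 1 / (Real.pi * ‖v - w‖)) := by
  have hv : (0 : ℝ) ≤ ‖v‖ ^ 4 := by positivity
  have hw : (0 : ℝ) ≤ ‖w‖ ^ 4 := by positivity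
  have h1 : (1 : ℝ) ≤ 1 + ‖v‖ ^ 4 + ‖w‖ ^ 4 := by linarith
  have h2 : (1 : ℝ) ≤ 1 + 1 / (Real.pi * ‖v - w‖) := by
    have : (0 : ℝ) ≤ 1 / (Real.pi * ‖v - w‖) := by positivity
    linarith
  nlinarith

/-- One contact term: `|1{c} Fn| ≤ C · 1{c} W` when `|Fn| ≤ C`, `0 ≤ C` and `1 ≤ W`. [folklore] -/
theorem abs_ite_le {c : Prop} [Decidable c] {x C W : ℝ} (hx : |x| ≤ C) (hC : 0 ≤ C) (hW : 1 ≤ W) :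
    |(if c then x else 0)| ≤ C * (if c then W else 0) := by
  split_ifs
  · calc |x| ≤ C := hx
      _ = C * 1 := (mul_one C).symm
      _ ≤ C * W := mul_le_mul_of_nonneg_left hW hC
  · simp

/-! ## §2 Compactness bounds: `χ` on `[0, τ] × 𝕋³`, `g` on `[0, M]`, the tent density -/

/-- A continuous weight on `ℝ × 𝕋³` is bounded on the compact slab `[0, τ] × 𝕋³`. [folklore] -/
theorem exists_bound_on_slab (χ : ℝ × UnitAddTorus (Fin 3) → ℝ) (hχ : Continuous χ) (τ : ℝ) :
    ∃ C : ℝ, 0 ≤ C ∧ ∀ s ∈ Set.Icc (0 : ℝ) τ, ∀ x : UnitAddTorus (Fin 3), |χ (s, x)| ≤ C := by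
  obtain ⟨C, hC⟩ :=
    (isCompact_Icc.prod isCompact_univ).exists_bound_of_continuousOn (hχ.continuousOn
      (s := Set.Icc (0 : ℝ) τ ×ˢ (Set.univ : Set (UnitAddTorus (Fin 3)))))
  refine ⟨max C 0, le_max_right _ _, fun s hs x => ?_⟩
  have h := hC (s, x) ⟨hs, Set.mem_univ _⟩
  rw [Real.norm_eq_abs] at h
  exact h.trans (le_max_left _ _)

/-- A continuous function on `ℝ` is bounded on the compact interval `[0, M]`. [folklore] -/
theorem exists_bound_on_Icc (g : ℝ → ℝ) (hg : Continuous g) (M : ℝ) :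
    ∃ C : ℝ, 0 ≤ C ∧ ∀ a : ℝ, 0 ≤ a → a ≤ M → |g a| ≤ C := by
  obtain ⟨C, hC⟩ := (isCompact_Icc (a := (0 : ℝ)) (b := M)).exists_bound_of_continuousOn
    hg.continuousOn
  refine ⟨max C 0, le_max_right _ _, fun a h0 hM => ?_⟩
  have h := hC a ⟨h0, hM⟩
  rw [Real.norm_eq_abs] at h
  exact h.trans (le_max_left _ _)

/-- The tent-mollified empirical density, rescaled by `c ≥ 0`, lies in `[0, c · 3/(πr³)]`: the
tent `b_r(x, y) = 3/(πr³) · max(1 − dist(x, y)/r, 0)` takes values in `[0, 3/(πr³)]` and the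
empirical measure of `N + 1` particles is an average (`integral_empiricalMeasure`). [folklore] -/
theorem tent_integral_bounds {N : ℕ} (w : Config (N + 1) (Fin 3) T3) {r : ℝ} (hr : 0 < r)
    (x₀ : UnitAddTorus (Fin 3)) {c : ℝ} (hc : 0 ≤ c) :
    0 ≤ c * ∫ q, 3 / (Real.pi * r ^ 3) * max (1 - Torus.euclidDist q.1 x₀ / r) 0
        ∂(empiricalMeasure w) ∧
      c * ∫ q, 3 / (Real.pi * r ^ 3) * max (1 - Torus.euclidDist q.1 x₀ / r) 0
        ∂(empiricalMeasure w) ≤ c * (3 / (Real.pi * r ^ 3)) := by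
  have hA : (0 : ℝ) ≤ 3 / (Real.pi * r ^ 3) := by positivity
  have hb0 : ∀ q : UnitAddTorus (Fin 3) × V3,
      0 ≤ 3 / (Real.pi * r ^ 3) * max (1 - Torus.euclidDist q.1 x₀ / r) 0 := fun q =>
    mul_nonneg hA (le_max_right _ _)
  have hb1 : ∀ q : UnitAddTorus (Fin 3) × V3,
      3 / (Real.pi * r ^ 3) * max (1 - Torus.euclidDist q.1 x₀ / r) 0 ≤ 3 / (Real.pi * r ^ 3) := by
    intro q
    have hd : 0 ≤ Torus.euclidDist q.1 x₀ / r := by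
      rw [Torus.euclidDist_eq]
      positivity
    have hmax : max (1 - Torus.euclidDist q.1 x₀ / r) 0 ≤ 1 := max_le (by linarith) zero_le_one
    calc 3 / (Real.pi * r ^ 3) * max (1 - Torus.euclidDist q.1 x₀ / r) 0
        ≤ 3 / (Real.pi * r ^ 3) * 1 := mul_le_mul_of_nonneg_left hmax hA
      _ = 3 / (Real.pi * r ^ 3) := mul_one _
  have hn : (0 : ℝ) < ((N + 1 : ℕ) : ℝ) := by positivity
  rw [integral_empiricalMeasure]
  constructor
  · exact mul_nonneg hc (mul_nonneg (inv_nonneg.2 hn.le) (Finset.sum_nonneg fun i _ => hb0 _))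
  · refine mul_le_mul_of_nonneg_left ?_ hc
    calc ((N + 1 : ℕ) : ℝ)⁻¹ * ∑ i, 3 / (Real.pi * r ^ 3) * max (1 - Torus.euclidDist (w i).1 x₀ / r) 0
        ≤ ((N + 1 : ℕ) : ℝ)⁻¹ * ∑ _i : Fin (N + 1), 3 / (Real.pi * r ^ 3) := by
          gcongr with i
          exact hb1 (w i)
      _ = 3 / (Real.pi * r ^ 3) := by
          rw [Finset.sum_const, Finset.card_univ, Fintype.card_fin, nsmul_eq_mul,
            inv_mul_cancel_left₀ hn.ne']

/-! ## §3 The pathwise bound along a good orbit -/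

/-- **A bounded-mark collision functional is dominated by the quartic tightness functional,
pathwise.** Along a good orbit of the hard-sphere flow on `𝕋³` (`ε = hsDiameter σ N`), if every
mark at a collision time in `[0, τ]` has `|Fn| ≤ C` (`C ≥ 0`), then
`|(ε/(N+1)) Σ_{collisions s ∈ [0, τ]} Σ_{ordered contact pairs} Fn|`
`≤ C · (ε/(N+1)) ∫ (1 + |v⁻|⁴ + |v*⁻|⁴)(1 + 1/(π|v⁻ − v*⁻|)) dκ_N([0, τ])`: unfold the integral to the
same collision sum (`HardSphereFlow.integral_empiricalCollisionMeasure_eq_finsum_ite`; finitely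
many collision times on the good set) and compare termwise, the weight being `≥ 1`. [folklore] -/
theorem bounded_functional_le {σ : ℝ} (hσ : 0 < σ) {N : ℕ}
    (Φ : HardSphereFlow (Torus.geometry (Fin 3)) (hsDiameter σ N) (N + 1))
    {z : Config (N + 1) (Fin 3) T3} (hz : z ∈ Φ.good) (τ : ℝ) {C : ℝ} (hC : 0 ≤ C)
    (Fn : ℝ → Fin (N + 1) → Fin (N + 1) → ℝ)
    (hFn : ∀ s, s ∈ Set.Icc (0 : ℝ) τ → ∀ i j, |Fn s i j| ≤ C) :
    |hsDiameter σ N / (N + 1 : ℝ) *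
        ∑ᶠ (s : ℝ) (_ : s ∈ collisionTimes (Torus.geometry (Fin 3)) (hsDiameter σ N)
          (fun t => Φ.flow t z) ∩ Set.Icc 0 τ),
          ∑ i : Fin (N + 1), ∑ j : Fin (N + 1),
            (if i ≠ j ∧ ‖(Torus.geometry (Fin 3)).sepVec (Φ.flow s z i).1 (Φ.flow s z j).1‖ =
                hsDiameter σ N then Fn s i j else 0)| ≤
      C * (hsDiameter σ N / (N + 1 : ℝ) *
        ∫ m, (1 + ‖m.2.2.2.1‖ ^ 4 + ‖m.2.2.2.2‖ ^ 4) * (1 + 1 / (Real.pi * ‖m.2.2.2.1 - m.2.2.2.2‖))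
          ∂(Φ.empiricalCollisionMeasure (Set.Icc 0 τ) z)) := by
  have hεN : 0 ≤ hsDiameter σ N / (N + 1 : ℝ) :=
    div_nonneg (hsDiameter_pos hσ N).le (by positivity)
  have hfin := Φ.finite_collisionTimes_inter hz (Set.Subset.refl (Set.Icc 0 τ))
  rw [Φ.integral_empiricalCollisionMeasure_eq_finsum_ite hz (Set.Subset.refl (Set.Icc 0 τ)),
    finsum_mem_eq_finite_toFinset_sum _ hfin, finsum_mem_eq_finite_toFinset_sum _ hfin, abs_mul,
    abs_of_nonneg hεN, mul_left_comm]
  refine mul_le_mul_of_nonneg_left ?_ hεN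
  rw [Finset.mul_sum]
  refine (Finset.abs_sum_le_sum_abs _ _).trans (Finset.sum_le_sum fun s hs => ?_)
  have hsI : s ∈ Set.Icc (0 : ℝ) τ := ((Set.Finite.mem_toFinset hfin).1 hs).2
  rw [Finset.mul_sum]
  refine (Finset.abs_sum_le_sum_abs _ _).trans (Finset.sum_le_sum fun i _ => ?_)
  rw [Finset.mul_sum]
  refine (Finset.abs_sum_le_sum_abs _ _).trans (Finset.sum_le_sum fun j _ => ?_)
  exact abs_ite_le (hFn s hsI i j) hC (one_le_weight _ _)

/-! ## §4 The event bound and the registered stub -/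

/-- **The event bound at one particle number.** If the tightness event
`{Kb < (ε/(N+1)) ∫ (1 + |v⁻|⁴ + |v*⁻|⁴)(1 + 1/(π|v⁻ − v*⁻|)) dκ_N}` has local-Gibbs probability `≤ b`
and the marks at collision times in `[0, τ]` are bounded by `C ≥ 0`, then the event
`{C · max(Kb, 0) < |K_N[Fn]|}` has probability `≤ b`: off the bad set, which is null for the local
Gibbs law (`localGibbsLaw_compl_good`), the latter is contained in the former
(`bounded_functional_le`). [folklore] -/
theorem measure_bounded_event_le {σ : ℝ} (hσ : 0 < σ) {a₀ θ₀ : T3 → ℝ} {u₀ : T3 → V3} {N : ℕ}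
    (Φ : HardSphereFlow (Torus.geometry (Fin 3)) (hsDiameter σ N) (N + 1)) (τ : ℝ) {C : ℝ}
    (hC : 0 ≤ C) (Kb : ℝ) {b : ℝ≥0∞}
    (hKb : localGibbsLaw σ a₀ u₀ θ₀ N Φ {z | Kb < hsDiameter σ N / (N + 1 : ℝ) *
      ∫ m, (1 + ‖m.2.2.2.1‖ ^ 4 + ‖m.2.2.2.2‖ ^ 4) * (1 + 1 / (Real.pi * ‖m.2.2.2.1 - m.2.2.2.2‖))
        ∂(Φ.empiricalCollisionMeasure (Set.Icc 0 τ) z)} ≤ b)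
    (Fn : Config (N + 1) (Fin 3) T3 → ℝ → Fin (N + 1) → Fin (N + 1) → ℝ)
    (hFn : ∀ z s, s ∈ Set.Icc (0 : ℝ) τ → ∀ i j, |Fn z s i j| ≤ C) :
    localGibbsLaw σ a₀ u₀ θ₀ N Φ {z | C * max Kb 0 < |hsDiameter σ N / (N + 1 : ℝ) *
        ∑ᶠ (s : ℝ) (_ : s ∈ collisionTimes (Torus.geometry (Fin 3)) (hsDiameter σ N)
          (fun t => Φ.flow t z) ∩ Set.Icc 0 τ),
          ∑ i : Fin (N + 1), ∑ j : Fin (N + 1),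
            (if i ≠ j ∧ ‖(Torus.geometry (Fin 3)).sepVec (Φ.flow s z i).1 (Φ.flow s z j).1‖ =
                hsDiameter σ N then Fn z s i j else 0)|} ≤ b := by
  rw [← measure_inter_conull (localGibbsLaw_compl_good σ a₀ θ₀ u₀ N Φ)]
  refine le_trans (measure_mono fun z hz => ?_) hKb
  have h1 : C * max Kb 0 < _ := hz.1
  have h2 := bounded_functional_le hσ Φ hz.2 τ hC (Fn z) (hFn z)
  have h3 : C * max Kb 0 < C * _ := h1.trans_le h2
  by_contra h4
  have h5 : C * (hsDiameter σ N / (N + 1 : ℝ) *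
      ∫ m, (1 + ‖m.2.2.2.1‖ ^ 4 + ‖m.2.2.2.2‖ ^ 4) * (1 + 1 / (Real.pi * ‖m.2.2.2.1 - m.2.2.2.2‖))
        ∂(Φ.empiricalCollisionMeasure (Set.Icc 0 τ) z)) ≤ C * max Kb 0 :=
    mul_le_mul_of_nonneg_left ((not_lt.1 h4).trans (le_max_left _ _)) hC
  exact absurd (h3.trans_le h5) (lt_irrefl _)

/-- **STUB `stub_maxwellDefectTight` (line `Sketch`, crux `ParityBandClosure`, stmt-17608):
tightness of the Metropolis rejection statistic of the collision record from quartic collision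
tightness.** GIVEN `LimitCollisionMeasure.CollisionTightness` (stmt-13354), for local Gibbs data
with continuous positive profiles there is `σ₀ > 0` (the one of the tightness statement) such that
for `0 < σ < σ₀`, every family of flows, every `τ > 0`, every continuous weight `χ`, continuous
cutoff `g`, `r, ϑ > 0` and `δ > 0` there are `K` and `N₀` with
`P(K < |K_N[χ(s, xᵢ) g(σ³ρ_r(s, xᵢ)) (1 − min(1, e^{−F}))]|) ≤ δ` for `N ≥ N₀`: take `Kb, N₀` from
tightness at `δ`, `Cχ ≥ |χ|` on `[0, τ] × 𝕋³`, `Cg ≥ |g|` on `[0, σ³ · 3/(πr³)]` and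
`K = Cχ · Cg · max(Kb, 0)` (`measure_bounded_event_le`, `abs_mark_le`, `tent_integral_bounds`).
[folklore] -/
theorem stub_maxwellDefectTight : LimitCollisionMeasure.CollisionTightness → ∀ (a₀ θ₀ : T3 → ℝ) (u₀ : T3 → V3), Continuous a₀ → Continuous θ₀ → Continuous u₀ → (∀ x, 0 < a₀ x) → (∀ x, 0 < θ₀ x) → ∃ σ₀ : ℝ, 0 < σ₀ ∧ ∀ σ : ℝ, 0 < σ → σ < σ₀ → ∀ Φ : (N : ℕ) → HardSphereFlow (Torus.geometry (Fin 3)) (hsDiameter σ N) (N + 1), ∀ τ : ℝ, 0 < τ → ∀ χ : ℝ × UnitAddTorus (Fin 3) → ℝ, Continuous χ → ∀ g : ℝ → ℝ, Continuous g → ∀ r ϑ : ℝ, 0 < r → 0 < ϑ → ∀ δ : ℝ, 0 < δ → ∃ K : ℝ, ∃ N₀ : ℕ, ∀ N : ℕ, N₀ ≤ N → let ε := hsDiameter σ N; let G := Torus.geometry (Fin 3); let γ := fun z (s : ℝ) => (Φ N).flow s z; let bx : UnitAddTorus (Fin 3) → UnitAddTorus (Fin 3) → ℝ := fun x y => 3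 / (Real.pi * r ^ 3) * max (1 - Torus.euclidDist x y / r) 0; let ρm := fun z s (x₀ : UnitAddTorus (Fin 3)) => ∫ q, bx q.1 x₀ ∂(empiricalMeasure (γ z s)); let hm := fun z s (x₀ : UnitAddTorus (Fin 3)) (v : EuclideanSpace ℝ (Fin 3)) => ∫ q, bx q.1 x₀ * localMaxwellian 1 (ϑ ^ 2) v q.2 ∂(empiricalMeasure (γ z s)); let pv := fun z s (i j : Fin (N + 1)) => reflectVel (G.sepVec (γ z s i).1 (γ z s j).1) ((γ z s i).2, (γ z s j).2); let F := fun z s (i j : Fin (N + 1)) => Real.log (hm z s (γ z s i).1 (pv z s i j).1) + Real.log (hm z s (γ z s i).1 (pv z s i j).2) - Real.log (hm z s (γ z s i).1 (γ z s i).2) - Real.log (hm z s (γ z s i).1 (γ z s j).2); let Kc := fun (Fn : Config (N + 1) (Fin 3) T3 → ℝ → Fin (N + 1) → Fin (N + 1) → ℝ) z => ε / (N + 1 : ℝ) * ∑ᶠ (s : ℝ) (_ : s ∈ collisionTimes G ε (γ z) ∩ Set.Icc 0 τ), ∑ i : Fin (N + 1), ∑ j : Fin (N + 1), (if i ≠ j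 ∧ ‖G.sepVec (γ z s i).1 (γ z s j).1‖ = ε then Fn z s i j else 0); let D := fun z => Kc (fun z s i j => χ (s, (γ z s i).1) * g (σ ^ 3 * ρm z s (γ z s i).1) * (1 - min 1 (Real.exp (-F z s i j)))) z; localGibbsLaw σ a₀ u₀ θ₀ N (Φ N) {z | K < |D z|} ≤ ENNReal.ofReal δ := by
  intro hCT a₀ θ₀ u₀ ha hθ hu ha0 hθ0
  obtain ⟨σ₀, hσ₀, H⟩ := hCT a₀ θ₀ u₀ ha hθ hu ha0 hθ0
  refine ⟨σ₀, hσ₀, fun σ hσ hσlt Φ τ hτ χ hχ g hg r ϑ hr hϑ δ hδ => ?_⟩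
  obtain ⟨Kb, N₀, hKb⟩ := H σ hσ hσlt Φ τ hτ δ hδ
  obtain ⟨Cχ, hCχ0, hCχ⟩ := exists_bound_on_slab χ hχ τ
  obtain ⟨Cg, hCg0, hCg⟩ := exists_bound_on_Icc g hg (σ ^ 3 * (3 / (Real.pi * r ^ 3)))
  refine ⟨Cχ * Cg * max Kb 0, N₀, fun N hN => ?_⟩
  refine measure_bounded_event_le hσ (Φ N) τ (mul_nonneg hCχ0 hCg0) Kb (hKb N hN) _ ?_
  intro z s hs i j
  exact abs_mark_le (hCχ s hs _) (hCg _ (tent_integral_bounds _ hr _ (pow_nonneg hσ.le 3)).1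
    (tent_integral_bounds _ hr _ (pow_nonneg hσ.le 3)).2) _

end Summit.AtomisticToContinuum.HydrodynamicLimit.Theorems.ParityBandClosureMaxwellDefect

end
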